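import Literature.AnabelianGeometry.AbsoluteAnabelian.AbsTopIII.AutHolLogFrobenius
import Literature.AnabelianGeometry.AbsoluteAnabelian.AbsTopIII.FrobeniusPictureMLFShift
import HarnessLib

/-!
# [AbsTopIII] §4, Corollary 4.5 (i) and (v) discharged over the abstract input data

Mochizuki, *Topics in Absolute Anabelian Geometry III*, Corollary 4.5 (i) p. 108 of the author's
kurims manuscript (lit key `paper:url-5493eb38cbb7`; bib key `MochizukiAbsTopIII2015`): "For
`n = 4, 5, 6`, `𝒟_{≤n}` admits a natural structure of core on `𝒟_{≤n−1}`. That is to say, loosely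
speaking, `ℰ`, `LinHol` 'form cores' of the functors in `𝒟`."  PROOF-ONLY companion of
`AbsTopIII/AutHolLogFrobenius.lean` (block W2-B4, node `AbsTopIII:Cor4.5(i)`): the typed statement
`Cor_4_5_i Δ = Δ.CoreStmt4 ∧ Δ.CoreStmt5 ∧ Δ.CoreStmt6` holds for EVERY input datum
`Δ : LogFrobeniusData`, by seat abc-iut-L4-t5's constructions `coreStmt4/5/6`
(`AbsTopIII/FrobeniusPictureMLFCores.lean`: every functor of `𝒟` lies over `ℰ` — `log` via
`logIsoId`, the `λ`'s via `lamTimes_NtoE` / `lamPf_NtoE`, `κ` via `κ_inv` — whence the core families).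
The printed proof says exactly this: "Assertions (i), (ii) are immediate from the definitions [and
the functorial algorithms of Corollary 2.7]" (p. 109).  Likewise (v) (`Cor_4_5_v Δ = Δ.NexusRigidStmt
∧ Δ.ShiftStmt`): the `ℤ`-action by shifts is t5's `shiftStmt` (`FrobeniusPictureMLFShift.lean`) for
every `Δ`, and "`□` is a nexus, `𝒟` totally `□`-rigid" is, by t5's `nexusRigidStmt_iff`, EQUIVALENT to
the total rigidity of the pre-nexus portion `𝒟_{≤□}` — the one model-dependent input ("a consequence
of the equivalence of categories of Cor. 2.3 (ii)" in the printed proof, p. 110): `cor_4_5_v_of_rigid`.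
Nothing here concerns the geometric instance.
-/

namespace Literature.AnabelianGeometry.AbsoluteAnabelian.AbsTopIII

universe u

/-- **Cor. 4.5 (i) holds for every input datum**: `ℰ`, `𝒜 = LinHol`, `ℰ` form cores of `𝒟_{≤3}`,
`𝒟_{≤4}`, `𝒟_{≤5}` ("immediate from the definitions", proof of Cor. 4.5 p. 109).
[cite: MochizukiAbsTopIII2015, Corollary 4.5 (i) p.108] -/
theorem cor_4_5_i_holds (Δ : LogFrobeniusData.{u}) : Cor_4_5_i Δ :=
  ⟨Δ.coreStmt4, Δ.coreStmt5, Δ.coreStmt6⟩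

/-- **Cor. 4.5 (v), reduced to the rigidity of `𝒟_{≤□}`**: for every input datum whose pre-nexus
portion (the copies of `𝒳` with `log`, `id_⋎`) is totally rigid — for the data of Def. 4.1 this is the
`Aut`-freeness of the first row, "a consequence of … Corollary 2.3, (ii)" (proof p. 110) — `□` is a
nexus, `𝒟` is totally `□`-rigid, and `ℤ` acts by the shifts (t5's `nexusRigidStmt_iff`, `shiftStmt`).
[cite: MochizukiAbsTopIII2015, Corollary 4.5 (v) p.109] -/
theorem cor_4_5_v_of_rigid (Δ : LogFrobeniusData.{u})
    (h : (Δ.diagram.restrict ({a : LFVertex | a.row = 1} ∪ {LFVertex.nexus})).IsTotallyRigid) :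
    Cor_4_5_v Δ :=
  ⟨Δ.nexusRigidStmt_iff.mpr h, Δ.shiftStmt⟩

end Literature.AnabelianGeometry.AbsoluteAnabelian.AbsTopIII
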